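import Summits.QuantumAdvantage.QuantumAdvantage.Statement
import Mathlib.Algebra.Order.BigOperators.Group.Finset
import Mathlib.Algebra.Order.Field.Basic
import Mathlib.Data.Real.Basic
import Mathlib.Tactic.Linarith
import Mathlib.Tactic.Positivity
import Mathlib.Tactic.Ring
import Mathlib.Tactic.FieldSimp
import HarnessLib

/-!
# Finite skeleton of the real/blinded bridge and of the content hybrid (Theorem H_Q of the wall)

Solo/blind wall, rider (α) on Q11 (v17, prose: `paper/generic-rung.md` §6.7–6.8, working file
`work/s17/theoremHQ.md`). THEOREM H_Q builds an oracle `B` with `P^B = BPP^B = BQP^B` such that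
`BQP^{B ⊕ G} ⊄ BPP^{B ⊕ G}` for every `G` Cohen-generic relative to `B`; hence the implication
"`BQP^G ⊄ BPP^G` for generic `G` ⟹ `BQP ⊄ BPP`" has no relativizing proof. Three purely
arithmetical steps of that proof are isolated here, over abstract data, so that a referee only has
to check that the wall's quantities satisfy the hypotheses.

* `soloBlind_marginSquaredMarkov` — §6.4, the ROW BRIDGE step. For a bounded-error-total machine the
  real and blinded acceptance probabilities differ by `Δ u` (depending on the secret `u`), the
  BBBV hybrid bound gives `Δ u ^ 2 ≤ 16 t · M u` pointwise (`M u` = query magnitude on the strings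
  where the two oracles differ), and a differing row forces `|Δ u| ≥ 1/3`. Then the number of
  secrets with a differing row is at most `144 t · Σ_u M u`. (Squaring before averaging is what
  keeps the level recursion linear.)
* `soloBlind_levelRecursion` — §6.4 / audit-H (S): the discrepancy recursion over padding levels,
  `f 0 ≤ 0`, `f (m+1) ≤ c (δ + f m)` with `c ≥ 1`, gives `f m ≤ (2c)^m δ`; in the wall
  `c = 144 t²` (quantum) or `3t` (classical), `δ = 2^{-n}`, `m ≤ log₂ log₂ t + 1`.
* `soloBlind_collisionSum` — §6.2, the CONTENT HYBRID step: a classical decision tree of depth `D`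
  probing a Simon table whose period is uniform among `M > D²` candidates meets a coset collision
  with probability at most `Σ_{i<D} i/(M - i²) ≤ D²/(M - D²)`.

No definitions, no `sorry`.
-/


namespace Summit.QuantumAdvantage.QuantumAdvantage.Theorems

open Finset

/-- ROW BRIDGE, counting form (theoremHQ §6.4). If `Δ u ^ 2 ≤ 16 t M u` for every secret `u ∈ U`,
`M ≥ 0` on `U`, and every `u` in `S ⊆ U` has `1/3 ≤ |Δ u|`, then `#S ≤ 144 t Σ_{u ∈ U} M u`. -/
theorem soloBlind_marginSquaredMarkov {α : Type*} (U S : Finset α) (hSU : S ⊆ U)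
    (Δ M : α → ℝ) (t : ℝ) (ht : 0 ≤ t)
    (hM : ∀ u ∈ U, 0 ≤ M u)
    (hyb : ∀ u ∈ U, Δ u ^ 2 ≤ 16 * t * M u)
    (margin : ∀ u ∈ S, (1 : ℝ) / 3 ≤ |Δ u|) :
    (S.card : ℝ) ≤ 144 * t * ∑ u ∈ U, M u := by
  have key : ∀ u ∈ S, (1 : ℝ) ≤ 144 * t * M u := by
    intro u hu
    have h1 := margin u hu
    have h2 := hyb u (hSU hu)
    have habs : |Δ u| ^ 2 = Δ u ^ 2 := sq_abs (Δ u)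
    have h3 : (1 : ℝ) / 9 ≤ |Δ u| ^ 2 := by nlinarith [h1, abs_nonneg (Δ u)]
    rw [habs] at h3
    linarith
  calc (S.card : ℝ) = ∑ u ∈ S, (1 : ℝ) := by simp
    _ ≤ ∑ u ∈ S, 144 * t * M u := Finset.sum_le_sum key
    _ = 144 * t * ∑ u ∈ S, M u := by rw [Finset.mul_sum]
    _ ≤ 144 * t * ∑ u ∈ U, M u := by
        have hsub : ∑ u ∈ S, M u ≤ ∑ u ∈ U, M u :=
          Finset.sum_le_sum_of_subset_of_nonneg hSU (fun u hu _ => hM u hu)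
        have h144 : (0 : ℝ) ≤ 144 * t := by positivity
        exact mul_le_mul_of_nonneg_left hsub h144

/-- LEVEL RECURSION (theoremHQ §6.4; audit-H (S)). -/
theorem soloBlind_levelRecursion (f : ℕ → ℝ) (c δ : ℝ) (hc : 1 ≤ c) (hδ : 0 ≤ δ)
    (h0 : f 0 ≤ 0) (hstep : ∀ m, f (m + 1) ≤ c * (δ + f m)) :
    ∀ m, f m ≤ (2 * c) ^ m * δ := by
  intro m
  induction m with
  | zero => simpa using le_trans h0 hδ
  | succ m ih =>
      have hc0 : 0 ≤ c := le_trans zero_le_one hc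
      have hpow : (1 : ℝ) ≤ (2 * c) ^ m := one_le_pow₀ (by linarith)
      have h1 : f (m + 1) ≤ c * (δ + (2 * c) ^ m * δ) := by
        have := hstep m
        have hmono : c * (δ + f m) ≤ c * (δ + (2 * c) ^ m * δ) :=
          mul_le_mul_of_nonneg_left (by linarith) hc0
        linarith
      have h2 : c * (δ + (2 * c) ^ m * δ) ≤ (2 * c) ^ (m + 1) * δ := by
        have : δ ≤ (2 * c) ^ m * δ := by nlinarith
        have h3 : c * (δ + (2 * c) ^ m * δ) ≤ c * (2 * ((2 * c) ^ m * δ)) :=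
          mul_le_mul_of_nonneg_left (by linarith) hc0
        have h4 : c * (2 * ((2 * c) ^ m * δ)) = (2 * c) ^ (m + 1) * δ := by ring
        linarith
      linarith

/-- CONTENT HYBRID, collision count (theoremHQ §6.2): `Σ_{i<D} i/(M - i²) ≤ D²/(M - D²)` when `D² < M`. -/
theorem soloBlind_collisionSum (D : ℕ) (M : ℝ) (hM : (D : ℝ) ^ 2 < M) :
    ∑ i ∈ Finset.range D, (i : ℝ) / (M - (i : ℝ) ^ 2) ≤ (D : ℝ) ^ 2 / (M - (D : ℝ) ^ 2) := by
  have hden : 0 < M - (D : ℝ) ^ 2 := by linarith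
  have term : ∀ i ∈ Finset.range D, (i : ℝ) / (M - (i : ℝ) ^ 2) ≤ (D : ℝ) / (M - (D : ℝ) ^ 2) := by
    intro i hi
    have hiD : (i : ℝ) < D := by exact_mod_cast Finset.mem_range.mp hi
    have hi0 : (0 : ℝ) ≤ i := by positivity
    have hisq : (i : ℝ) ^ 2 ≤ (D : ℝ) ^ 2 := by nlinarith
    have hdeni : 0 < M - (i : ℝ) ^ 2 := by linarith
    calc (i : ℝ) / (M - (i : ℝ) ^ 2) ≤ (i : ℝ) / (M - (D : ℝ) ^ 2) := by
            apply div_le_div_of_nonneg_left hi0 hden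
            linarith
      _ ≤ (D : ℝ) / (M - (D : ℝ) ^ 2) := by
            apply div_le_div_of_nonneg_right (le_of_lt hiD) (le_of_lt hden)
  calc ∑ i ∈ Finset.range D, (i : ℝ) / (M - (i : ℝ) ^ 2)
      ≤ ∑ i ∈ Finset.range D, (D : ℝ) / (M - (D : ℝ) ^ 2) := Finset.sum_le_sum term
    _ = (D : ℝ) * ((D : ℝ) / (M - (D : ℝ) ^ 2)) := by simp [Finset.sum_const, Finset.card_range]
    _ = (D : ℝ) ^ 2 / (M - (D : ℝ) ^ 2) := by ring

end Summit.QuantumAdvantage.QuantumAdvantage.Theorems
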